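import Summits.KontsevichZagierPeriods.Zeta5Search.Barrier.ConeGammaCuspSlopeTangentConeWalls

/-!
# ζ(5) search — BARRIER: THE CONVEXITY TYPE OF THE CUSP SLOPE NEAR A DISPLACEMENT — an hypothesis-free criterion in
# reference form (file (1) of «CONVEXITY TYPE»)

HONEST FRAMING (cell `pub-zeta5`): systematic search; no irrationality claim unless kernel-certified. MODEL objects
under Brown–Zudilin's (28)+(30) accounting ([BZ22] = arXiv:2210.03391; (28) observed, not proved); nothing here is a
statement about `ζ(5)`, any `γ` of record, the cone's supremum (C2 OPEN) or the value / sign of the cusp slope, of a chamber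
weight, of a wall defect or of a one-sided derivative at a named direction (DATA of the cell); NO cancellation is quantified;
S-E / (TD_A) stay CONJECTURED; records in print UNMOVED. Prover P2 g44 (item «CONVEXITY TYPE» = P2 g43's successor menu (c);
plan INBOX 2026-08-28). Sources: P2 g43 `ConeGammaCuspSlopeTangentCone` / `…Walls` (the tangent cone is attained on a
neighbourhood; the differentiability and extremum criteria), P2 g42 `ConeGammaCuspSlopeLexGerm` (`sign_window`,
`exists_common_window`, `exists_generic_refines_lex`), P2 g30 `ConeGammaCuspGermKink` (`greedy_sub_greedy_of_adjacent`).

SETTING. `a` with all 28 forms positive, `T > 0` a period, `σ = cuspSlope a T`, rates `r_k(θ) = φ_k(θ)/h_k(a)`, `F` the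
canonical period pattern function, `W_k(δ₀) = F(P≤(k)) − F(P<(k))` the canonical chamber weights of a generic reference `δ₀`,
`L_{δ₀}(Δ) = Σ_k W_k(δ₀)·r_k(Δ)` its chamber functional. P2 g43: near every displacement `δ`, `σ(δ') = σ(δ) + L_{δ₀}(δ' − δ)`
for every generic `δ₀` refining the lexicographic order of `(δ, δ' − δ)` — `σ` is `σ(δ)` plus ONE positively homogeneous
piecewise-linear function `D_δ` of `δ' − δ` (its one-sided derivative). P2 g30/g31 gave SUFFICIENT conditions for the GLOBAL
convexity type of `σ` (sub/super-modular junctions or period pattern function — at the directions of record NONE of the pure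
types holds, DATA). Here the convexity type NEAR A DISPLACEMENT is CHARACTERISED, with no modularity hypothesis:
* **`convexOn_nhds_iff_of_germ` (abstract: any `f` whose tangent cone at `δ` is attained on a neighbourhood with chamber
  functionals `Δ ↦ Σ_k W_k(δ₀)·r_k(Δ)`) and `convexOn_cuspSlope_nhds_iff` — THE CONVEXITY CRITERION: `σ` is convex on some
  neighbourhood of `δ` iff for every direction `Δ`, every generic `δ₀` refining the lexicographic order of `(δ, Δ)` and every
  generic `δ₀'` refining `δ`: `L_{δ₀'}(Δ) ≤ L_{δ₀}(Δ)`** — the one-sided derivative `D_δ` is the MAXIMUM of the chamber functionals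
  of the generic references refining `δ` (⇒: a three-point convexity inequality along the open local cone of `δ₀'`; ⇐: a maximum
  of linear functionals is convex, and `σ = σ(δ) + D_δ(· − δ)` nearby); **`concaveOn_nhds_iff_of_germ`,
  `concaveOn_cuspSlope_nhds_iff`** — the twins (`D_δ` the MINIMUM; via Mathlib's `neg_convexOn_iff` and `germ_neg`).
  At a generic `δ` both are vacuous (`σ` is affine nearby); at a simple tie they read `m_F ≥ 0` / `m_F ≤ 0` at its wall.
Files (2) `ConeGammaCuspSlopeConvexityWalls` (differentiable ⟺ convex and concave nearby; a locally convex `σ` with a local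
maximum is flat; the sign of the REALISED adjacent wall defects), (3) `ConeGammaCuspSlopeConvexityOrbit` (the closed orbit
`δ = 0`: convex ⟺ convex near `0` ⟺ subadditive ⟺ `σ` is the maximum of ALL chamber functionals; a subadditive cusp slope
with no ascent direction is `≡ 0`) and (4) `ConeGammaTranslateConvexity` (the translate integral `P` inside the rate ball and
at the closed orbit) continue.
NOT here (honest): the convexity type at any named direction, any value of `F`, `W_k` or of a defect (DATA); `Φ`, `γ`, C2,
S-E's truth, `ζ(5)`.
-/

noncomputable section

open Set Finset Filter
open scoped Topology

namespace Summit.KontsevichZagierPeriods.Zeta5Search.Barrier.ConeGamma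

/-! ### Scaling, lines and windows -/

/-- **The lexicographic order of `(δ, c•Δ)`, `c > 0`, is that of `(δ, Δ)`**: a reference refining the latter refines the former. -/
theorem refines_lex_smul {a : Dir} {δ Δ δ₀ : Fin 8 → ℝ} {c : ℝ} (hc : 0 < c)
    (hlex : ∀ k l : Fin 28, (phiForm δ k / h28 a k < phiForm δ l / h28 a l ∨
        (phiForm δ k / h28 a k = phiForm δ l / h28 a l ∧ phiForm Δ k / h28 a k < phiForm Δ l / h28 a l)) →
      phiForm δ₀ k / h28 a k < phiForm δ₀ l / h28 a l) :
    ∀ k l : Fin 28, (phiForm δ k / h28 a k < phiForm δ l / h28 a l ∨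
        (phiForm δ k / h28 a k = phiForm δ l / h28 a l ∧
          phiForm (c • Δ) k / h28 a k < phiForm (c • Δ) l / h28 a l)) →
      phiForm δ₀ k / h28 a k < phiForm δ₀ l / h28 a l := by
  intro k l h
  refine hlex k l (h.imp_right fun h' => ⟨h'.1, ?_⟩)
  have hs := h'.2
  rw [rate_smul, rate_smul] at hs
  exact lt_of_mul_lt_mul_left hs hc.le

/-- The segment map `t ↦ δ + t•v` tends to `δ` as `t → 0⁺`. -/
theorem tendsto_add_smul_nhdsGT (δ v : Fin 8 → ℝ) :
    Tendsto (fun t : ℝ => δ + t • v) (𝓝[>] 0) (𝓝 δ) := by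
  have hc : Continuous fun t : ℝ => δ + t • v := continuous_const.add (continuous_id.smul continuous_const)
  have h0 := hc.tendsto 0
  rw [zero_smul, add_zero] at h0
  exact h0.mono_left nhdsWithin_le_nhds

/-- **WINDOW: the open local cone of a refining reference.** If `δ₀` is a generic reference refining `δ`, then for every
direction `Δ` there is `s₀ > 0` such that `δ₀` refines the lexicographic order of `(δ, (δ₀ − δ) + s•Δ)` for all `0 < s ≤ s₀`
(the tied pairs of `δ` are strictly ordered by `δ₀ − δ` as by `δ₀`, and strict inequalities survive a small perturbation). -/
theorem exists_window_refines_lex_self_sub_add_smul {a : Dir} {δ δ₀ : Fin 8 → ℝ}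
    (hgen : ∀ k l : Fin 28, k ≠ l → phiForm δ₀ k / h28 a k ≠ phiForm δ₀ l / h28 a l)
    (href : ∀ k l : Fin 28, phiForm δ k / h28 a k < phiForm δ l / h28 a l →
      phiForm δ₀ k / h28 a k < phiForm δ₀ l / h28 a l) (Δ : Fin 8 → ℝ) :
    ∃ s₀ : ℝ, 0 < s₀ ∧ ∀ s : ℝ, 0 < s → s ≤ s₀ →
      ∀ k l : Fin 28, (phiForm δ k / h28 a k < phiForm δ l / h28 a l ∨
          (phiForm δ k / h28 a k = phiForm δ l / h28 a l ∧
            phiForm ((δ₀ - δ) + s • Δ) k / h28 a k < phiForm ((δ₀ - δ) + s • Δ) l / h28 a l)) →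
        phiForm δ₀ k / h28 a k < phiForm δ₀ l / h28 a l := by
  obtain ⟨s₀, hs₀, hw⟩ := exists_common_window (Finset.univ : Finset (Fin 28 × Fin 28))
    (fun kl s => phiForm δ kl.1 / h28 a kl.1 = phiForm δ kl.2 / h28 a kl.2 →
      phiForm δ₀ kl.2 / h28 a kl.2 < phiForm δ₀ kl.1 / h28 a kl.1 →
        phiForm ((δ₀ - δ) + s • Δ) kl.2 / h28 a kl.2 < phiForm ((δ₀ - δ) + s • Δ) kl.1 / h28 a kl.1)
    (fun kl _ => by
      by_cases htie : phiForm δ kl.1 / h28 a kl.1 = phiForm δ kl.2 / h28 a kl.2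
      · by_cases hlt : phiForm δ₀ kl.2 / h28 a kl.2 < phiForm δ₀ kl.1 / h28 a kl.1
        · obtain ⟨t₀, ht₀, h⟩ := sign_window
            (phiForm (δ₀ - δ) kl.1 / h28 a kl.1 - phiForm (δ₀ - δ) kl.2 / h28 a kl.2)
            (phiForm Δ kl.1 / h28 a kl.1 - phiForm Δ kl.2 / h28 a kl.2)
          refine ⟨t₀, ht₀, fun t ht hle _ _ => ?_⟩
          have hp : 0 < phiForm (δ₀ - δ) kl.1 / h28 a kl.1 - phiForm (δ₀ - δ) kl.2 / h28 a kl.2 := by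
            rw [rate_sub, rate_sub]; linarith
          have e : phiForm ((δ₀ - δ) + t • Δ) kl.1 / h28 a kl.1 - phiForm ((δ₀ - δ) + t • Δ) kl.2 / h28 a kl.2 =
              (phiForm (δ₀ - δ) kl.1 / h28 a kl.1 - phiForm (δ₀ - δ) kl.2 / h28 a kl.2) +
                t * (phiForm Δ kl.1 / h28 a kl.1 - phiForm Δ kl.2 / h28 a kl.2) := by
            rw [rate_add_smul, rate_add_smul]; ring
          have h' := (h t ht hle).mpr (Or.inl hp)
          linarith
        · exact ⟨1, one_pos, fun t _ _ _ h => absurd h hlt⟩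
      · exact ⟨1, one_pos, fun t _ _ h _ => absurd h htie⟩)
  refine ⟨s₀, hs₀, fun s hs hle k l h => ?_⟩
  rcases h with h | ⟨he, hlt⟩
  · exact href k l h
  · rcases lt_trichotomy (phiForm δ₀ k / h28 a k) (phiForm δ₀ l / h28 a l) with h1 | h1 | h1
    · exact h1
    · by_cases hkl : k = l
      · subst hkl; exact absurd hlt (lt_irrefl _)
      · exact absurd h1 (hgen k l hkl)
    · exact absurd (hw s hs hle (k, l) (Finset.mem_univ _) he h1) (lt_asymm hlt)

/-! ### THE CRITERION, abstract form: any function whose tangent cone is attained on a neighbourhood -/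

/-- **LOCALLY CONVEX ⇒ EVERY REFINING CHAMBER FUNCTIONAL IS DOMINATED BY THE ONE-SIDED DERIVATIVE** (abstract form). Let `f` be
a function on `ℝ⁸` whose tangent cone at `δ` is attained on a neighbourhood with chamber functionals `Σ_k W_k(δ₁)·r_k`: for all
`δ'` near `δ` and every generic reference `δ₁` refining the lexicographic order of `(δ, δ' − δ)`,
`f(δ') = f(δ) + Σ_k W_k(δ₁)·r_k(δ' − δ)` (hypothesis `hgerm`; for `σ` this is P2 g43's `cuspSlope_eq_add_lex_functional_eventually`).
If `f` is convex on a neighbourhood of `δ`, then for every direction `Δ`, every generic `δ₀` refining the lexicographic order of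
`(δ, Δ)` and every generic `δ₀'` refining `δ`: **`Σ_k W_k(δ₀')·r_k(Δ) ≤ Σ_k W_k(δ₀)·r_k(Δ)`** (convexity between the three points
`δ + ε(δ₀' − δ)`, `δ + εs₀Δ` and their midpoint, `ε` small, `s₀` from the window of `δ₀'`). -/
theorem germ_greedy_le_of_convexOn {a : Dir} {f : (Fin 8 → ℝ) → ℝ} {W : (Fin 8 → ℝ) → Fin 28 → ℝ}
    {δ : Fin 8 → ℝ}
    (hgerm : ∀ᶠ δ' in 𝓝 δ, ∀ δ₁ : Fin 8 → ℝ,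
      (∀ k l : Fin 28, k ≠ l → phiForm δ₁ k / h28 a k ≠ phiForm δ₁ l / h28 a l) →
      (∀ k l : Fin 28, (phiForm δ k / h28 a k < phiForm δ l / h28 a l ∨
          (phiForm δ k / h28 a k = phiForm δ l / h28 a l ∧
            phiForm (δ' - δ) k / h28 a k < phiForm (δ' - δ) l / h28 a l)) →
        phiForm δ₁ k / h28 a k < phiForm δ₁ l / h28 a l) →
      f δ' = f δ + ∑ k, W δ₁ k * (phiForm (δ' - δ) k / h28 a k))
    (hconv : ∃ U ∈ 𝓝 δ, ConvexOn ℝ U f) (Δ : Fin 8 → ℝ) {δ₀ δ₀' : Fin 8 → ℝ}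
    (hgen : ∀ k l : Fin 28, k ≠ l → phiForm δ₀ k / h28 a k ≠ phiForm δ₀ l / h28 a l)
    (hgen' : ∀ k l : Fin 28, k ≠ l → phiForm δ₀' k / h28 a k ≠ phiForm δ₀' l / h28 a l)
    (hlex : ∀ k l : Fin 28, (phiForm δ k / h28 a k < phiForm δ l / h28 a l ∨
        (phiForm δ k / h28 a k = phiForm δ l / h28 a l ∧ phiForm Δ k / h28 a k < phiForm Δ l / h28 a l)) →
      phiForm δ₀ k / h28 a k < phiForm δ₀ l / h28 a l)
    (href' : ∀ k l : Fin 28, phiForm δ k / h28 a k < phiForm δ l / h28 a l →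
      phiForm δ₀' k / h28 a k < phiForm δ₀' l / h28 a l) :
    ∑ k, W δ₀' k * (phiForm Δ k / h28 a k) ≤ ∑ k, W δ₀ k * (phiForm Δ k / h28 a k) := by
  obtain ⟨U, hU, hUc⟩ := hconv
  obtain ⟨L, hL⟩ := exists_clm_greedy a (W δ₀)
  obtain ⟨L', hL'⟩ := exists_clm_greedy a (W δ₀')
  rw [← hL Δ, ← hL' Δ]
  -- the window of `δ₀'` in the direction `Δ`
  obtain ⟨s₀, hs₀, hw⟩ := exists_window_refines_lex_self_sub_add_smul hgen' href' Δ
  -- a scale `ε > 0` at which the three points lie in `U` and in the germ set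
  have hS := (Filter.eventually_mem_set.mpr hU).and hgerm
  have hposε : ∀ᶠ ε in 𝓝[>] (0 : ℝ), ε ∈ Ioi (0 : ℝ) := eventually_mem_nhdsWithin
  obtain ⟨ε, hε, ⟨hxU, hxg⟩, ⟨hyU, hyg⟩, ⟨-, hzg⟩⟩ :=
    (hposε.and ((((tendsto_add_smul_nhdsGT δ (δ₀' - δ)).eventually hS)).and
      ((((tendsto_add_smul_nhdsGT δ (s₀ • Δ)).eventually hS)).and
        ((tendsto_add_smul_nhdsGT δ ((1 / 2 : ℝ) • ((δ₀' - δ) + s₀ • Δ))).eventually hS)))).exists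
  have hε : (0 : ℝ) < ε := hε
  -- the three values of `f`
  have ex : δ + ε • (δ₀' - δ) - δ = ε • (δ₀' - δ) := add_sub_cancel_left _ _
  have ey : δ + ε • (s₀ • Δ) - δ = (ε * s₀) • Δ := by rw [add_sub_cancel_left, smul_smul]
  have ez : δ + ε • ((1 / 2 : ℝ) • ((δ₀' - δ) + s₀ • Δ)) - δ = (ε * (1 / 2)) • ((δ₀' - δ) + s₀ • Δ) := by
    rw [add_sub_cancel_left, smul_smul]
  have hfx : f (δ + ε • (δ₀' - δ)) = f δ + ε * L' (δ₀' - δ) := by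
    have h := hxg δ₀' hgen' (by rw [ex]; exact refines_lex_smul hε (refines_lex_self_sub href'))
    rw [ex, ← hL', map_smul, smul_eq_mul] at h
    exact h
  have hfy : f (δ + ε • (s₀ • Δ)) = f δ + ε * s₀ * L Δ := by
    have h := hyg δ₀ hgen (by rw [ey]; exact refines_lex_smul (mul_pos hε hs₀) hlex)
    rw [ey, ← hL, map_smul, smul_eq_mul] at h
    exact h
  have hfz : f (δ + ε • ((1 / 2 : ℝ) • ((δ₀' - δ) + s₀ • Δ))) =
      f δ + ε * (1 / 2) * (L' (δ₀' - δ) + s₀ * L' Δ) := by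
    have h := hzg δ₀' hgen' (by
      rw [ez]; exact refines_lex_smul (mul_pos hε one_half_pos) (hw s₀ hs₀ le_rfl))
    rw [ez, ← hL', map_smul, map_add, map_smul, smul_eq_mul, smul_eq_mul] at h
    exact h
  -- convexity between the three points
  have hmid : (1 / 2 : ℝ) • (δ + ε • (δ₀' - δ)) + (1 / 2 : ℝ) • (δ + ε • (s₀ • Δ)) =
      δ + ε • ((1 / 2 : ℝ) • ((δ₀' - δ) + s₀ • Δ)) := by
    ext i
    simp only [Pi.add_apply, Pi.smul_apply, Pi.sub_apply, smul_eq_mul]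
    ring
  have hc := hUc.2 hxU hyU (by norm_num : (0 : ℝ) ≤ 1 / 2) (by norm_num : (0 : ℝ) ≤ 1 / 2)
    (by norm_num : (1 / 2 : ℝ) + 1 / 2 = 1)
  rw [hmid, hfx, hfy, hfz, smul_eq_mul, smul_eq_mul] at hc
  have key : ε * s₀ * (L' Δ - L Δ) ≤ 0 := by
    have h := hc
    ring_nf at h ⊢
    linarith
  by_contra hlt
  have : 0 < ε * s₀ * (L' Δ - L Δ) := mul_pos (mul_pos hε hs₀) (sub_pos.mpr (not_le.mp hlt))
  linarith

/-- **EVERY REFINING CHAMBER FUNCTIONAL DOMINATED BY THE ONE-SIDED DERIVATIVE ⇒ LOCALLY CONVEX** (abstract form). All 28 forms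
of `a` positive; `f` with the tangent-cone germ `hgerm` at `δ` as in `germ_greedy_le_of_convexOn`. If for every `Δ`, every generic
`δ₀` refining the lexicographic order of `(δ, Δ)` and every generic `δ₀'` refining `δ`, `Σ_k W_k(δ₀')·r_k(Δ) ≤ Σ_k W_k(δ₀)·r_k(Δ)`, then
`f` is convex on a ball around `δ` (on the germ ball `f = f(δ) + max_{δ₀'} L_{δ₀'}(· − δ)`, a maximum of linear functionals). -/
theorem convexOn_of_germ_greedy_le {a : Dir} (hpos : ∀ k, 0 < h28 a k) {f : (Fin 8 → ℝ) → ℝ}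
    {W : (Fin 8 → ℝ) → Fin 28 → ℝ} {δ : Fin 8 → ℝ}
    (hgerm : ∀ᶠ δ' in 𝓝 δ, ∀ δ₁ : Fin 8 → ℝ,
      (∀ k l : Fin 28, k ≠ l → phiForm δ₁ k / h28 a k ≠ phiForm δ₁ l / h28 a l) →
      (∀ k l : Fin 28, (phiForm δ k / h28 a k < phiForm δ l / h28 a l ∨
          (phiForm δ k / h28 a k = phiForm δ l / h28 a l ∧
            phiForm (δ' - δ) k / h28 a k < phiForm (δ' - δ) l / h28 a l)) →
        phiForm δ₁ k / h28 a k < phiForm δ₁ l / h28 a l) →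
      f δ' = f δ + ∑ k, W δ₁ k * (phiForm (δ' - δ) k / h28 a k))
    (hle : ∀ Δ δ₀ δ₀' : Fin 8 → ℝ, (∀ k l : Fin 28, k ≠ l → phiForm δ₀ k / h28 a k ≠ phiForm δ₀ l / h28 a l) →
      (∀ k l : Fin 28, k ≠ l → phiForm δ₀' k / h28 a k ≠ phiForm δ₀' l / h28 a l) →
      (∀ k l : Fin 28, (phiForm δ k / h28 a k < phiForm δ l / h28 a l ∨
          (phiForm δ k / h28 a k = phiForm δ l / h28 a l ∧ phiForm Δ k / h28 a k < phiForm Δ l / h28 a l)) →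
        phiForm δ₀ k / h28 a k < phiForm δ₀ l / h28 a l) →
      (∀ k l : Fin 28, phiForm δ k / h28 a k < phiForm δ l / h28 a l →
        phiForm δ₀' k / h28 a k < phiForm δ₀' l / h28 a l) →
      ∑ k, W δ₀' k * (phiForm Δ k / h28 a k) ≤ ∑ k, W δ₀ k * (phiForm Δ k / h28 a k)) :
    ∃ ε : ℝ, 0 < ε ∧ ConvexOn ℝ (Metric.ball δ ε) f := by
  obtain ⟨ε, hε, hball⟩ := Metric.mem_nhds_iff.mp hgerm
  refine ⟨ε, hε, convex_ball δ ε, fun x hx y hy p q hp hq hpq => ?_⟩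
  have hz : p • x + q • y ∈ Metric.ball δ ε := convex_ball δ ε hx hy hp hq hpq
  obtain ⟨δx, hgx, hlx⟩ := exists_generic_refines_lex hpos δ (x - δ)
  obtain ⟨δy, hgy, hly⟩ := exists_generic_refines_lex hpos δ (y - δ)
  obtain ⟨δz, hgz, hlz⟩ := exists_generic_refines_lex hpos δ (p • x + q • y - δ)
  have ex := hball hx δx hgx hlx
  have ey := hball hy δy hgy hly
  have ez := hball hz δz hgz hlz
  have hrefz : ∀ k l : Fin 28, phiForm δ k / h28 a k < phiForm δ l / h28 a l →
      phiForm δz k / h28 a k < phiForm δz l / h28 a l := fun k l h => hlz k l (Or.inl h)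
  have h1 := hle (x - δ) δx δz hgx hgz hlx hrefz
  have h2 := hle (y - δ) δy δz hgy hgz hly hrefz
  obtain ⟨Lz, hLz⟩ := exists_clm_greedy a (W δz)
  have e : p • x + q • y - δ = p • (x - δ) + q • (y - δ) := by
    ext i
    simp only [Pi.add_apply, Pi.smul_apply, Pi.sub_apply, smul_eq_mul]
    linear_combination (δ i) * hpq
  rw [← hLz, e, map_add, map_smul, map_smul, smul_eq_mul, smul_eq_mul] at ez
  rw [← hLz] at h1 h2
  rw [ez, smul_eq_mul, smul_eq_mul]
  have h1' : p * Lz (x - δ) ≤ p * (f x - f δ) := mul_le_mul_of_nonneg_left (by linarith) hp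
  have h2' : q * Lz (y - δ) ≤ q * (f y - f δ) := mul_le_mul_of_nonneg_left (by linarith) hq
  have h3 : p * f δ + q * f δ = f δ := by rw [← add_mul, hpq, one_mul]
  have h4 : p * (f x - f δ) = p * f x - p * f δ := mul_sub _ _ _
  have h5 : q * (f y - f δ) = q * f y - q * f δ := mul_sub _ _ _
  linarith

/-- **THE LOCAL CONVEXITY CRITERION** (abstract form): under the germ hypothesis, `f` is convex on some neighbourhood of `δ` iff
every refining chamber functional is dominated, on every direction, by the lexicographic (one-sided derivative) functional. -/
theorem convexOn_nhds_iff_of_germ {a : Dir} (hpos : ∀ k, 0 < h28 a k) {f : (Fin 8 → ℝ) → ℝ}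
    {W : (Fin 8 → ℝ) → Fin 28 → ℝ} {δ : Fin 8 → ℝ}
    (hgerm : ∀ᶠ δ' in 𝓝 δ, ∀ δ₁ : Fin 8 → ℝ,
      (∀ k l : Fin 28, k ≠ l → phiForm δ₁ k / h28 a k ≠ phiForm δ₁ l / h28 a l) →
      (∀ k l : Fin 28, (phiForm δ k / h28 a k < phiForm δ l / h28 a l ∨
          (phiForm δ k / h28 a k = phiForm δ l / h28 a l ∧
            phiForm (δ' - δ) k / h28 a k < phiForm (δ' - δ) l / h28 a l)) →
        phiForm δ₁ k / h28 a k < phiForm δ₁ l / h28 a l) →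
      f δ' = f δ + ∑ k, W δ₁ k * (phiForm (δ' - δ) k / h28 a k)) :
    (∃ U ∈ 𝓝 δ, ConvexOn ℝ U f) ↔
      ∀ Δ δ₀ δ₀' : Fin 8 → ℝ, (∀ k l : Fin 28, k ≠ l → phiForm δ₀ k / h28 a k ≠ phiForm δ₀ l / h28 a l) →
        (∀ k l : Fin 28, k ≠ l → phiForm δ₀' k / h28 a k ≠ phiForm δ₀' l / h28 a l) →
        (∀ k l : Fin 28, (phiForm δ k / h28 a k < phiForm δ l / h28 a l ∨
            (phiForm δ k / h28 a k = phiForm δ l / h28 a l ∧ phiForm Δ k / h28 a k < phiForm Δ l / h28 a l)) →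
          phiForm δ₀ k / h28 a k < phiForm δ₀ l / h28 a l) →
        (∀ k l : Fin 28, phiForm δ k / h28 a k < phiForm δ l / h28 a l →
          phiForm δ₀' k / h28 a k < phiForm δ₀' l / h28 a l) →
        ∑ k, W δ₀' k * (phiForm Δ k / h28 a k) ≤ ∑ k, W δ₀ k * (phiForm Δ k / h28 a k) := by
  constructor
  · intro h Δ δ₀ δ₀' hgen hgen' hlex href'
    exact germ_greedy_le_of_convexOn hgerm h Δ hgen hgen' hlex href'
  · intro h
    obtain ⟨ε, hε, hc⟩ := convexOn_of_germ_greedy_le hpos hgerm h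
    exact ⟨Metric.ball δ ε, Metric.ball_mem_nhds δ hε, hc⟩

/-- The germ of `−f` has the chamber weights `−W`. -/
theorem germ_neg {a : Dir} {f : (Fin 8 → ℝ) → ℝ} {W : (Fin 8 → ℝ) → Fin 28 → ℝ} {δ : Fin 8 → ℝ}
    (hgerm : ∀ᶠ δ' in 𝓝 δ, ∀ δ₁ : Fin 8 → ℝ,
      (∀ k l : Fin 28, k ≠ l → phiForm δ₁ k / h28 a k ≠ phiForm δ₁ l / h28 a l) →
      (∀ k l : Fin 28, (phiForm δ k / h28 a k < phiForm δ l / h28 a l ∨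
          (phiForm δ k / h28 a k = phiForm δ l / h28 a l ∧
            phiForm (δ' - δ) k / h28 a k < phiForm (δ' - δ) l / h28 a l)) →
        phiForm δ₁ k / h28 a k < phiForm δ₁ l / h28 a l) →
      f δ' = f δ + ∑ k, W δ₁ k * (phiForm (δ' - δ) k / h28 a k)) :
    ∀ᶠ δ' in 𝓝 δ, ∀ δ₁ : Fin 8 → ℝ,
      (∀ k l : Fin 28, k ≠ l → phiForm δ₁ k / h28 a k ≠ phiForm δ₁ l / h28 a l) →
      (∀ k l : Fin 28, (phiForm δ k / h28 a k < phiForm δ l / h28 a l ∨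
          (phiForm δ k / h28 a k = phiForm δ l / h28 a l ∧
            phiForm (δ' - δ) k / h28 a k < phiForm (δ' - δ) l / h28 a l)) →
        phiForm δ₁ k / h28 a k < phiForm δ₁ l / h28 a l) →
      (-f) δ' = (-f) δ + ∑ k, (-W) δ₁ k * (phiForm (δ' - δ) k / h28 a k) := by
  filter_upwards [hgerm] with δ' h δ₁ hgen hlex
  rw [Pi.neg_apply, Pi.neg_apply, h δ₁ hgen hlex, neg_add, ← Finset.sum_neg_distrib]
  refine congrArg _ (Finset.sum_congr rfl fun k _ => ?_)
  rw [Pi.neg_apply, Pi.neg_apply, neg_mul]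

/-- **THE LOCAL CONCAVITY CRITERION** (abstract form): under the germ hypothesis, `f` is concave on some neighbourhood of `δ` iff
every refining chamber functional DOMINATES, on every direction, the lexicographic (one-sided derivative) functional. -/
theorem concaveOn_nhds_iff_of_germ {a : Dir} (hpos : ∀ k, 0 < h28 a k) {f : (Fin 8 → ℝ) → ℝ}
    {W : (Fin 8 → ℝ) → Fin 28 → ℝ} {δ : Fin 8 → ℝ}
    (hgerm : ∀ᶠ δ' in 𝓝 δ, ∀ δ₁ : Fin 8 → ℝ,
      (∀ k l : Fin 28, k ≠ l → phiForm δ₁ k / h28 a k ≠ phiForm δ₁ l / h28 a l) →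
      (∀ k l : Fin 28, (phiForm δ k / h28 a k < phiForm δ l / h28 a l ∨
          (phiForm δ k / h28 a k = phiForm δ l / h28 a l ∧
            phiForm (δ' - δ) k / h28 a k < phiForm (δ' - δ) l / h28 a l)) →
        phiForm δ₁ k / h28 a k < phiForm δ₁ l / h28 a l) →
      f δ' = f δ + ∑ k, W δ₁ k * (phiForm (δ' - δ) k / h28 a k)) :
    (∃ U ∈ 𝓝 δ, ConcaveOn ℝ U f) ↔
      ∀ Δ δ₀ δ₀' : Fin 8 → ℝ, (∀ k l : Fin 28, k ≠ l → phiForm δ₀ k / h28 a k ≠ phiForm δ₀ l / h28 a l) →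
        (∀ k l : Fin 28, k ≠ l → phiForm δ₀' k / h28 a k ≠ phiForm δ₀' l / h28 a l) →
        (∀ k l : Fin 28, (phiForm δ k / h28 a k < phiForm δ l / h28 a l ∨
            (phiForm δ k / h28 a k = phiForm δ l / h28 a l ∧ phiForm Δ k / h28 a k < phiForm Δ l / h28 a l)) →
          phiForm δ₀ k / h28 a k < phiForm δ₀ l / h28 a l) →
        (∀ k l : Fin 28, phiForm δ k / h28 a k < phiForm δ l / h28 a l →
          phiForm δ₀' k / h28 a k < phiForm δ₀' l / h28 a l) →
        ∑ k, W δ₀ k * (phiForm Δ k / h28 a k) ≤ ∑ k, W δ₀' k * (phiForm Δ k / h28 a k) := by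
  have hneg : (∃ U ∈ 𝓝 δ, ConcaveOn ℝ U f) ↔ ∃ U ∈ 𝓝 δ, ConvexOn ℝ U (-f) := by
    simp only [neg_convexOn_iff]
  rw [hneg, convexOn_nhds_iff_of_germ hpos (germ_neg hgerm)]
  refine forall₃_congr fun Δ δ₀ δ₀' => forall₄_congr fun _ _ _ _ => ?_
  simp only [Pi.neg_apply, neg_mul, Finset.sum_neg_distrib, neg_le_neg_iff]

/-! ### THE CONVEXITY TYPE OF `σ` NEAR A DISPLACEMENT -/

/-- **THE CONVEXITY CRITERION FOR THE CUSP SLOPE.** All 28 forms of `a` positive, `T > 0` a period, `F` the canonical period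
pattern function. Then **`σ = cuspSlope a T` is convex on some neighbourhood of `δ` iff for every direction `Δ`, every generic
reference `δ₀` refining the lexicographic order of `(δ, Δ)` and every generic reference `δ₀'` refining `δ`:
`Σ_k W_k(δ₀')·φ_k(Δ)/h_k(a) ≤ Σ_k W_k(δ₀)·φ_k(Δ)/h_k(a)`** — the one-sided derivative of `σ` at `δ` is the MAXIMUM of the chamber
functionals of the generic references refining `δ` (by `refines_lex_iff_cone` a finite criterion: one functional and one closed
polyhedral local cone per realised order). At a generic `δ`: vacuous (σ affine nearby); at a simple tie: `m_F ≥ 0` at its wall. -/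
theorem convexOn_cuspSlope_nhds_iff {a : Dir} (hpos : ∀ k, 0 < h28 a k) {T : ℝ} (hT : 0 < T)
    (hper : ∀ k : Fin 28, ∃ z : ℤ, T * h28 a k = z) {F : Finset (Fin 28) → ℝ}
    (hF : ∀ A, F A = ∑ m ∈ Finset.range ((bkpts a T).card - 1), ((patternN a (bkpt a T m) A : ℤ) : ℝ))
    (δ : Fin 8 → ℝ) :
    (∃ U ∈ 𝓝 δ, ConvexOn ℝ U (cuspSlope a T)) ↔
      ∀ Δ δ₀ δ₀' : Fin 8 → ℝ, (∀ k l : Fin 28, k ≠ l → phiForm δ₀ k / h28 a k ≠ phiForm δ₀ l / h28 a l) →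
        (∀ k l : Fin 28, k ≠ l → phiForm δ₀' k / h28 a k ≠ phiForm δ₀' l / h28 a l) →
        (∀ k l : Fin 28, (phiForm δ k / h28 a k < phiForm δ l / h28 a l ∨
            (phiForm δ k / h28 a k = phiForm δ l / h28 a l ∧ phiForm Δ k / h28 a k < phiForm Δ l / h28 a l)) →
          phiForm δ₀ k / h28 a k < phiForm δ₀ l / h28 a l) →
        (∀ k l : Fin 28, phiForm δ k / h28 a k < phiForm δ l / h28 a l →
          phiForm δ₀' k / h28 a k < phiForm δ₀' l / h28 a l) →
        ∑ k, (F (Finset.univ.filter fun l => phiForm δ₀' k / h28 a k ≤ phiForm δ₀' l / h28 a l) -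
            F (Finset.univ.filter fun l => phiForm δ₀' k / h28 a k < phiForm δ₀' l / h28 a l)) *
          (phiForm Δ k / h28 a k) ≤
        ∑ k, (F (Finset.univ.filter fun l => phiForm δ₀ k / h28 a k ≤ phiForm δ₀ l / h28 a l) -
            F (Finset.univ.filter fun l => phiForm δ₀ k / h28 a k < phiForm δ₀ l / h28 a l)) *
          (phiForm Δ k / h28 a k) :=
  convexOn_nhds_iff_of_germ hpos
    (W := fun δ₁ k => F (Finset.univ.filter fun l => phiForm δ₁ k / h28 a k ≤ phiForm δ₁ l / h28 a l) -
      F (Finset.univ.filter fun l => phiForm δ₁ k / h28 a k < phiForm δ₁ l / h28 a l))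
    (cuspSlope_eq_add_lex_functional_eventually hpos hT hper hF δ)

/-- **THE CONCAVITY CRITERION FOR THE CUSP SLOPE**: `σ` is concave on some neighbourhood of `δ` iff for every `Δ`, every generic
`δ₀` refining the lexicographic order of `(δ, Δ)` and every generic `δ₀'` refining `δ`,
`Σ_k W_k(δ₀)·φ_k(Δ)/h_k(a) ≤ Σ_k W_k(δ₀')·φ_k(Δ)/h_k(a)` — the one-sided derivative is the MINIMUM of the refining chamber
functionals (at a simple tie: `m_F ≤ 0`). -/
theorem concaveOn_cuspSlope_nhds_iff {a : Dir} (hpos : ∀ k, 0 < h28 a k) {T : ℝ} (hT : 0 < T)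
    (hper : ∀ k : Fin 28, ∃ z : ℤ, T * h28 a k = z) {F : Finset (Fin 28) → ℝ}
    (hF : ∀ A, F A = ∑ m ∈ Finset.range ((bkpts a T).card - 1), ((patternN a (bkpt a T m) A : ℤ) : ℝ))
    (δ : Fin 8 → ℝ) :
    (∃ U ∈ 𝓝 δ, ConcaveOn ℝ U (cuspSlope a T)) ↔
      ∀ Δ δ₀ δ₀' : Fin 8 → ℝ, (∀ k l : Fin 28, k ≠ l → phiForm δ₀ k / h28 a k ≠ phiForm δ₀ l / h28 a l) →
        (∀ k l : Fin 28, k ≠ l → phiForm δ₀' k / h28 a k ≠ phiForm δ₀' l / h28 a l) →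
        (∀ k l : Fin 28, (phiForm δ k / h28 a k < phiForm δ l / h28 a l ∨
            (phiForm δ k / h28 a k = phiForm δ l / h28 a l ∧ phiForm Δ k / h28 a k < phiForm Δ l / h28 a l)) →
          phiForm δ₀ k / h28 a k < phiForm δ₀ l / h28 a l) →
        (∀ k l : Fin 28, phiForm δ k / h28 a k < phiForm δ l / h28 a l →
          phiForm δ₀' k / h28 a k < phiForm δ₀' l / h28 a l) →
        ∑ k, (F (Finset.univ.filter fun l => phiForm δ₀ k / h28 a k ≤ phiForm δ₀ l / h28 a l) -
            F (Finset.univ.filter fun l => phiForm δ₀ k / h28 a k < phiForm δ₀ l / h28 a l)) *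
          (phiForm Δ k / h28 a k) ≤
        ∑ k, (F (Finset.univ.filter fun l => phiForm δ₀' k / h28 a k ≤ phiForm δ₀' l / h28 a l) -
            F (Finset.univ.filter fun l => phiForm δ₀' k / h28 a k < phiForm δ₀' l / h28 a l)) *
          (phiForm Δ k / h28 a k) :=
  concaveOn_nhds_iff_of_germ hpos
    (W := fun δ₁ k => F (Finset.univ.filter fun l => phiForm δ₁ k / h28 a k ≤ phiForm δ₁ l / h28 a l) -
      F (Finset.univ.filter fun l => phiForm δ₁ k / h28 a k < phiForm δ₁ l / h28 a l))
    (cuspSlope_eq_add_lex_functional_eventually hpos hT hper hF δ)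

end Summit.KontsevichZagierPeriods.Zeta5Search.Barrier.ConeGamma

end
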